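import Summits.CriticalPhenomena.PercolationContinuityZ3.Theorems.Transplant.SkelFrmBParamsFaceFloorsLYA
import Summits.CriticalPhenomena.PercolationContinuityZ3.Theorems.Transplant.SkelFrmBParamsFaceCountsRangeYA
import Summits.CriticalPhenomena.PercolationContinuityZ3.Theorems.Transplant.SkelFrmBParamsFaceCountsShiftYA
import Summits.CriticalPhenomena.PercolationContinuityZ3.Theorems.Transplant.SkelFrmBParamsFaceRunA
import Summits.CriticalPhenomena.PercolationContinuityZ3.Theorems.Transplant.PlanarSkeletonFrmDefs
import Summits.CriticalPhenomena.PercolationContinuityZ3.Theorems.Transplant.SkelPhiStepIDataNS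
import HarnessLib
/-!
(F) VALUE LAYER, N2 twin (hp-8 g42, 2026-08-23; F-DISCHARGE-MAP-N2 G18, y′-face landing floors AT THE COUNTS): `port_frm.py` text of N1 `SkelNegBParamsFaceFloorsLAdYA`
(stmt-g17) re-fitted: generic cells `(P : PCells2T) (hP : P.toPCells2 = fcellsA …)`; creep-aware staggered targets `T0Y/T1Y P x du z` and counts `NrY/N3Y/σTY … P … du …`
(FaceCountsYA-N2, RangeYA-N2 `N3Y + 1 ≤ 240·Kq + 10`); kit radius `KS0.R'0` (J19); window `BSlot.small = (30u₀, 8u₁)` through LYA-N2's `FL?_YA_gen`; `hq3_hℓk_YA` at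
`N3 + 1 ≤ 240·Kq + 10` (`(1240·Kq + 10)·R'0 ≤ n_L ⟸ 2000·Kq·(R'0+2) ≤ n_L`); `ℓL_le_u₁A` verbatim (stmt's `fcellsA_s_at`/`mA_eq`, p1's `units_eqA`).
NON-VACUITY: every hypothesis is served by the face frame (`hlev1/2`, `hz/hkE`) or is a floor of record (`hnA`, `hℓ`, `hs0`, `hs1`, `EqNumL`, `|h_L| ≤ 10n_L`).
builds on p205010 (kernel theorem, internal audit signed; external expert review pending); nothing here is a claim about the open node `SamePDropOfSkeletonFrm₁`.
N1 HEADER (kept for the reader):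
# N1 params, M3 y′-FACE — **THE LAST-CORE FLOORS `FL1`–`FL4` PINNED AT THE COUNTS** (adapters for hp-8 g36's landed `KS.FL?_YA_gen`, LYA p325366):
# the premises `hT0`, `hT1`, `hq3`, `hℓk` at `yT := yL + crossOffY … (sgOf du) (NrY …)`, `τ := σTY`, `q := qB3YA (RA′ mk)`, `k := N3Y + 1`, for a GENERIC
# origin `yL` with the readings `|FcA yL| ≤ 6·u₀A`, `|F1cA yL| ≤ 6·u₁A`.
# KEY FACT for `hT1` (p3-g12's LOCATED #2, lane INBOX 2026-08-22T10:39:44Z, asked for a sharper drift lemma): none is needed — the cell unit IS the level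
# stride count, `u₁A = s₁ = ⌊m/U_L⌋ − 1` (`fcellsA_s_at`, `mA_eq`, `L1hat = n_L + |h_L|`), hence **`ℓL_le_u₁A : ℓ_L ≤ 11·u₁A + 23`** (`m > n_L(ℓ_L − 1)`,
# `U_L ≤ 11·n_L`), so the LANDED drift bound `2(NrY+1) + 2 ≤ 1200·Kq + 2` (ShiftYA `F1cA_crossOffY_sub_abs_le`, RangeYA `NrY_range`) is `≤ 2·u₁A`
# (`u₁A ≥ 4000·Kq − 3` from `22000·Kq·(RA′+2) ≤ ℓ_L`): **`hT1_YA : |F1cA yT − T1Y| ≤ 3·u₁A`**.  Also **`hT0_YA`** (`N3Y_spec` + `FcA_crossOffY_sub_abs_le`),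
# **`hq3_YA`**, **`hℓk_YA`**, and the four fields bundled: **`floorsFL_YA`** = `FloorsY2.FL1–FL4` (index form, after `rw [hd]`).  (stmt-g17 2026-08-22.)
builds on p205010 (kernel theorem, internal audit signed; external expert review pending) — nothing in this file uses p205010; NOTHING is claimed about the node
`SamePDropOfSkeletonNeg₁` (OPEN); arithmetic only.
Lane `prim-bschramm-*`, seat `prim-bschramm-stmt` (gen 17); helper file (`--supports stmt-CriticalPhenomena-4575 --as helper`).
[cite: KozmaNitzan2024, §4 Lemma 12 (pp. 23–25)] [cite: MartineauTassion2017, §4.1]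
-/

noncomputable section

open scoped Classical

namespace Summit.CriticalPhenomena.PercolationContinuityZ3.Theorems.Transplant

namespace PlanarSkeletonFrm

namespace NegB

open Literature.Probability.Percolation Literature.Probability.LatticeModels SimpleGraph
open Literature.Probability.Percolation.KozmaNitzan.Cells (sgOf sgOf_sign oth)
open SkelConc (Consts)
open Skelφ (shearUnit shearUnit_pos xCoreB xCSLo xCSHi)
open Skelφ.StepI (DataN)
open TwoAxis.Para (modulus)
open Neg

namespace KS

section LAd

/-- **The cell unit bounds the layer: `ℓ_L ≤ 11·u₁A + 23`** (`u₁A = ⌊m/U_L⌋ − 1`, `U_L = n_L + |h_L| ≤ 11n_L`, `m > n_L(ℓ_L − 1)`). [folklore] -/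
theorem ℓL_le_u₁A (κ : Consts) {V : Type} [DecidableEq V] [Countable V] {G : SimpleGraph V} [G.LocallyFinite] (Φ : PlanarSkeletonFrm G) (t : V) (p : unitInterval) (D : Skelφ.StepI.DataNS V) (g : ℕ) (f : ℕ) (hN : EqNumL κ Φ t p D g f) (hκ : (hL κ Φ t p D g f).natAbs ≤ 10 * nL κ Φ t p D g f) :
    (ℓL κ Φ t p D g f : ℤ) ≤ 11 * u₁A κ Φ t p D g f + 23 := by
  obtain ⟨hn1, hℓ1⟩ := one_le_of_eqNumL κ Φ t p D g f hN
  have hm := (Skelφ.NegPrm.modulus_vβOf hn1 (hL κ Φ t p D g f) (ℓL κ Φ t p D g f) (vL κ Φ t p D g f)).1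
  have ev : vβL κ Φ t p D g f = Skelφ.NegPrm.vβOf (nL κ Φ t p D g f) (hL κ Φ t p D g f) (ℓL κ Φ t p D g f) (vL κ Φ t p D g f) := rfl
  rw [← ev] at hm
  have hu : u₁A κ Φ t p D g f = fm1A κ Φ t p D g f := by unfold u₁A; exact (fcellsA_s_at κ Φ t p D g f hN).2
  have e : fm1A κ Φ t p D g f = (modulus (nL κ Φ t p D g f) (hL κ Φ t p D g f) (vL κ Φ t p D g f) (vβL κ Φ t p D g f)) /
      (((nL κ Φ t p D g f) : ℤ) + |(hL κ Φ t p D g f)|) - 1 := by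
    unfold fm1A; rw [(mA_eq κ Φ t p D g f).2]; rfl
  have hκ' : |hL κ Φ t p D g f| ≤ 10 * (nL κ Φ t p D g f : ℤ) := by rw [← Int.natCast_natAbs]; exact_mod_cast hκ
  have hn : (1 : ℤ) ≤ (nL κ Φ t p D g f : ℤ) := by exact_mod_cast hn1
  have ha : 0 ≤ |hL κ Φ t p D g f| := abs_nonneg _
  rw [hu, e]
  set m := modulus (nL κ Φ t p D g f) (hL κ Φ t p D g f) (vL κ Φ t p D g f) (vβL κ Φ t p D g f)
  set L := (nL κ Φ t p D g f : ℤ) + |hL κ Φ t p D g f|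
  have hL0 : 0 < L := by positivity
  have h1 : m < L * (m / L) + L := Int.lt_mul_ediv_self_add hL0
  -- `n(ℓ − 1) < m < L(q + 1) ≤ 11n(q + 1)` with `q := m / L`
  have hq0 : 0 ≤ m / L + 1 := by
    have : 0 ≤ m / L := Int.ediv_nonneg (by nlinarith) hL0.le
    linarith
  have h2 : L * (m / L + 1) ≤ 11 * (nL κ Φ t p D g f : ℤ) * (m / L + 1) := mul_le_mul_of_nonneg_right (by linarith) hq0
  have h3 : (nL κ Φ t p D g f : ℤ) * ((ℓL κ Φ t p D g f : ℤ) - 1) < (nL κ Φ t p D g f : ℤ) * (11 * (m / L + 1)) := by nlinarith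
  have h4 : (ℓL κ Φ t p D g f : ℤ) - 1 < 11 * (m / L + 1) := lt_of_mul_lt_mul_left h3 (by linarith)
  linarith

/-- **`hT1` at the counts**: `|F1cA yT − T1Y| ≤ 3·u₁A` for `yT := yL + crossOffY … (sgOf du) NrY` (origin `|F1cA yL| ≤ 6u₁A`, band `faceL 1 j ∓ E`, `E ≤ 2u₁A`).
[cite: KozmaNitzan2024, §4 Lemma 12 (pp. 23–25)] -/
theorem hT1_YA (κ : Consts) {V : Type} [DecidableEq V] [Countable V] {G : SimpleGraph V} [G.LocallyFinite] (Φ : PlanarSkeletonFrm G) (t : V) (p : unitInterval) (D : Skelφ.StepI.DataNS V) (g : ℕ) (f : ℕ) (mk : ℕ) (P : PCells2T) (hP : P.toPCells2 = fcellsA κ Φ t p D g f) (hN : EqNumL κ Φ t p D g f) (hκ : (hL κ Φ t p D g f).natAbs ≤ 10 * nL κ Φ t p D g f)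
    (hℓ : 22000 * Neg.Kq κ * (KS0.R'0 κ Φ t p D mk + 2) ≤ ℓL κ Φ t p D g f)
    (x : Site 2) (du : MDir) (hd : du.1 = 1) (j : ℕ) (hj : j < P.K) (z : Site 2) {E : ℕ}
    (hlev1 : P.faceL 1 j - E ≤ P.lev du x z)
    (hlev2 : P.lev du x z ≤ P.faceL 1 j + E) (hEu : (E : ℤ) ≤ 2 * u₁A κ Φ t p D g f)
    (yL : Site 2) (he1 : |F1cA κ Φ t p D g f yL| ≤ 6 * u₁A κ Φ t p D g f) :
    |F1cA κ Φ t p D g f (yL + Skelφ.crossOffY (nL κ Φ t p D g f) (ℓL κ Φ t p D g f) (hL κ Φ t p D g f) (vL κ Φ t p D g f) (sgOf du) (NrY κ Φ t p D g f P yL x du z)) -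
        T1Y P x du z| ≤ 3 * u₁A κ Φ t p D g f := by
  have hσ : sgOf du = 1 ∨ sgOf du = -1 := sgOf_sign du
  obtain ⟨hX, hNr600⟩ := NrY_range κ Φ t p D g f P hP x du hd z hj hlev1 hlev2 yL he1 (by linarith)
  obtain ⟨hT1, -⟩ := NrY_spec κ Φ t p D g f P yL x du z hX
  have hD := F1cA_crossOffY_sub_abs_le κ Φ t p D g f hN hκ yL hσ (NrY κ Φ t p D g f P yL x du z)
  have hℓu := ℓL_le_u₁A κ Φ t p D g f hN hκ
  have hNr' : ((NrY κ Φ t p D g f P yL x du z : ℕ) : ℤ) + 1 ≤ 600 * (Neg.Kq κ : ℤ) := by exact_mod_cast hNr600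
  have hℓ' : 22000 * (Neg.Kq κ : ℤ) * ((KS0.R'0 κ Φ t p D mk : ℤ) + 2) ≤ (ℓL κ Φ t p D g f : ℤ) := by exact_mod_cast hℓ
  have hR0 : (0 : ℤ) ≤ (KS0.R'0 κ Φ t p D mk : ℤ) := by positivity
  set FT := F1cA κ Φ t p D g f (yL + Skelφ.crossOffY (nL κ Φ t p D g f) (ℓL κ Φ t p D g f) (hL κ Φ t p D g f) (vL κ Φ t p D g f) (sgOf du) (NrY κ Φ t p D g f P yL x du z))
  obtain ⟨d1, d2⟩ := abs_le.1 hD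
  obtain ⟨t1, t2⟩ := abs_le.1 hT1
  rw [abs_le]
  rcases hσ with h | h <;> rw [h] at d1 d2 t1 t2 <;> constructor <;> nlinarith

/-- **`hT0` at the counts**: `|FcA yT + σTY·u₀A·(N3Y+1) − T0Y| ≤ 3·u₀A` for `yT := yL + crossOffY … (sgOf du) NrY` (origin readings `≤ 6u`,
`6RA′ + 11 ≤ u₀A`). [cite: KozmaNitzan2024, §4 Lemma 12 (pp. 23–25)] -/
theorem hT0_YA (κ : Consts) {V : Type} [DecidableEq V] [Countable V] {G : SimpleGraph V} [G.LocallyFinite] (Φ : PlanarSkeletonFrm G) (t : V) (p : unitInterval) (D : Skelφ.StepI.DataNS V) (g : ℕ) (f : ℕ) (mk : ℕ) (P : PCells2T) (hP : P.toPCells2 = fcellsA κ Φ t p D g f) (hN : EqNumL κ Φ t p D g f) (hκ : (hL κ Φ t p D g f).natAbs ≤ 10 * nL κ Φ t p D g f)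
    (hℓ : 22000 * Neg.Kq κ * (KS0.R'0 κ Φ t p D mk + 2) ≤ ℓL κ Φ t p D g f) (hs0 : 6 * (KS0.R'0 κ Φ t p D mk : ℤ) + 11 ≤ u₀A κ Φ t p D g f)
    (x : Site 2) (du : MDir) (hd : du.1 = 1) (j : ℕ) (hj : j < P.K) (z : Site 2) {E : ℕ}
    (hlev1 : P.faceL 1 j - E ≤ P.lev du x z)
    (hlev2 : P.lev du x z ≤ P.faceL 1 j + E) (hEu : (E : ℤ) ≤ 2 * u₁A κ Φ t p D g f)
    (yL : Site 2) (he1 : |F1cA κ Φ t p D g f yL| ≤ 6 * u₁A κ Φ t p D g f) :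
    |FcA κ Φ t p D g f (yL + Skelφ.crossOffY (nL κ Φ t p D g f) (ℓL κ Φ t p D g f) (hL κ Φ t p D g f) (vL κ Φ t p D g f) (sgOf du) (NrY κ Φ t p D g f P yL x du z)) +
          σTY κ Φ t p D g f P yL x du z * u₀A κ Φ t p D g f * ((N3Y κ Φ t p D g f P yL x du z + 1 : ℕ) : ℤ) - T0Y P x du z| ≤
      3 * u₀A κ Φ t p D g f := by
  have hσ : sgOf du = 1 ∨ sgOf du = -1 := sgOf_sign du
  obtain ⟨-, hNr600⟩ := NrY_range κ Φ t p D g f P hP x du hd z hj hlev1 hlev2 yL he1 (by linarith)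
  have hNr' : ((NrY κ Φ t p D g f P yL x du z : ℕ) : ℤ) + 1 ≤ 600 * (Neg.Kq κ : ℤ) := by exact_mod_cast hNr600
  have hℓ' : 22000 * (Neg.Kq κ : ℤ) * ((KS0.R'0 κ Φ t p D mk : ℤ) + 2) ≤ (ℓL κ Φ t p D g f : ℤ) := by exact_mod_cast hℓ
  have hR0 : (0 : ℤ) ≤ (KS0.R'0 κ Φ t p D mk : ℤ) := by positivity
  have hℓN : 25 * ((NrY κ Φ t p D g f P yL x du z : ℤ) + 1) + 13 ≤ (ℓL κ Φ t p D g f : ℤ) := by nlinarith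
  have hF := FcA_crossOffY_sub_abs_le κ Φ t p D g f hN hκ yL hσ (NrY κ Φ t p D g f P yL x du z) hℓN (by linarith)
  obtain ⟨-, -, hN3⟩ := N3Y_spec κ Φ t p D g f P yL x du z
  have e : ((N3Y κ Φ t p D g f P yL x du z + 1 : ℕ) : ℤ) = (N3Y κ Φ t p D g f P yL x du z : ℤ) + 1 := by push_cast; ring
  rw [e]
  obtain ⟨f1, f2⟩ := abs_le.1 hF
  obtain ⟨n1, n2⟩ := abs_le.1 hN3
  rw [abs_le]; constructor <;> linarith

/-- **`hq3` and `hℓk` at the counts**: `qB3YA RA′ + (N3Y+1)·RA′ ≤ 3n_L` and `11·((N3Y+1)·RA′ + 4) ≤ ℓ_L` (`N3Y + 1 ≤ 240·Kq + 10`). [folklore] -/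
theorem hq3_hℓk_YA (κ : Consts) {V : Type} [DecidableEq V] [Countable V] {G : SimpleGraph V} [G.LocallyFinite] (Φ : PlanarSkeletonFrm G) (t : V) (p : unitInterval) (D : Skelφ.StepI.DataNS V) (g : ℕ) (f : ℕ) (mk : ℕ) (hnA : 2000 * Neg.Kq κ * (KS0.R'0 κ Φ t p D mk + 2) ≤ nL κ Φ t p D g f)
    (hℓ : 22000 * Neg.Kq κ * (KS0.R'0 κ Φ t p D mk + 2) ≤ ℓL κ Φ t p D g f) {N3 : ℕ} (hN3 : N3 + 1 ≤ 240 * Neg.Kq κ + 10) :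
    (((qB3YA κ Φ t p D g f (KS0.R'0 κ Φ t p D mk) : ℕ) : ℤ) + ((N3 + 1 : ℕ) : ℤ) * (KS0.R'0 κ Φ t p D mk : ℤ) ≤ 3 * (nL κ Φ t p D g f : ℤ)) ∧
      11 * (((N3 + 1 : ℕ) : ℤ) * (KS0.R'0 κ Φ t p D mk : ℤ) + 4) ≤ (ℓL κ Φ t p D g f : ℤ) := by
  have hq3 : ((qB3YA κ Φ t p D g f (KS0.R'0 κ Φ t p D mk) : ℕ) : ℤ) = 2 * (nL κ Φ t p D g f : ℤ) + 1000 * (Neg.Kq κ : ℤ) * (KS0.R'0 κ Φ t p D mk : ℤ) := by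
    unfold qB3YA; push_cast; ring
  have hnA' : 2000 * (Neg.Kq κ : ℤ) * ((KS0.R'0 κ Φ t p D mk : ℤ) + 2) ≤ (nL κ Φ t p D g f : ℤ) := by exact_mod_cast hnA
  have hℓ' : 22000 * (Neg.Kq κ : ℤ) * ((KS0.R'0 κ Φ t p D mk : ℤ) + 2) ≤ (ℓL κ Φ t p D g f : ℤ) := by exact_mod_cast hℓ
  have hk' : ((N3 + 1 : ℕ) : ℤ) ≤ 240 * (Neg.Kq κ : ℤ) + 10 := by exact_mod_cast hN3
  have hk0 : (0 : ℤ) ≤ ((N3 + 1 : ℕ) : ℤ) := by positivity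
  have hR0 : (0 : ℤ) ≤ (KS0.R'0 κ Φ t p D mk : ℤ) := by positivity
  have hKq : (1 : ℤ) ≤ (Neg.Kq κ : ℤ) := by exact_mod_cast Neg.one_le_Kq κ
  have h1 : ((N3 + 1 : ℕ) : ℤ) * (KS0.R'0 κ Φ t p D mk : ℤ) ≤ (240 * (Neg.Kq κ : ℤ) + 10) * (KS0.R'0 κ Φ t p D mk : ℤ) := mul_le_mul_of_nonneg_right hk' hR0
  rw [hq3]
  constructor <;> nlinarith

/-- **THE LAST-CORE FLOORS `FL1`–`FL4` OF THE y′-FACE AT THE COUNTS** (hp-8's `FL?_YA_gen` with every premise discharged; generic origin `yL` with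
`|FcA yL| ≤ 6u₀A`, `|F1cA yL| ≤ 6u₁A`; index form, i.e. after `rw [hd]`). [cite: KozmaNitzan2024, §4 Lemma 12 (pp. 23–25)] -/
theorem floorsFL_YA (κ : Consts) {V : Type} [DecidableEq V] [Countable V] {G : SimpleGraph V} [G.LocallyFinite] (Φ : PlanarSkeletonFrm G) (t : V) (p : unitInterval) (D : Skelφ.StepI.DataNS V) (g : ℕ) (f : ℕ) (mk : ℕ) (P : PCells2T) (hP : P.toPCells2 = fcellsA κ Φ t p D g f) (hN : EqNumL κ Φ t p D g f) (hκ : (hL κ Φ t p D g f).natAbs ≤ 10 * nL κ Φ t p D g f)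
    (hnA : 2000 * Neg.Kq κ * (KS0.R'0 κ Φ t p D mk + 2) ≤ nL κ Φ t p D g f) (hℓ : 22000 * Neg.Kq κ * (KS0.R'0 κ Φ t p D mk + 2) ≤ ℓL κ Φ t p D g f)
    (hs0 : 6 * (KS0.R'0 κ Φ t p D mk : ℤ) + 11 ≤ u₀A κ Φ t p D g f) (hs1 : 6 * (KS0.R'0 κ Φ t p D mk : ℤ) + 11 ≤ u₁A κ Φ t p D g f)
    (x : Site 2) (du : MDir) (hd : du.1 = 1) (j : ℕ) (hj : j < P.K) (z : Site 2) {E : ℕ} {kE : ℤ}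
    (hlev1 : P.faceL 1 j - E ≤ P.lev du x z)
    (hlev2 : P.lev du x z ≤ P.faceL 1 j + E) (hE2 : (E : ℤ) ≤ 2 * (KS0.R'0 κ Φ t p D mk : ℤ))
    (hz : |z 0 - P.cenS x 0| ≤ kE) (hkE : kE ≤ 5 * (P.r 0 : ℤ))
    (yL : Site 2) (he0 : |FcA κ Φ t p D g f yL| ≤ 6 * u₀A κ Φ t p D g f) (he1 : |F1cA κ Φ t p D g f yL| ≤ 6 * u₁A κ Φ t p D g f) :
    ((nL κ Φ t p D g f : ℤ) * modulus (nL κ Φ t p D g f) (hL κ Φ t p D g f) (vL κ Φ t p D g f) (vβL κ Φ t p D g f) *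
          (P.cenS (x + stepVec du) 0 - ((NegB.BSlot.small κ Φ t p D g f 0 : ℕ) : ℤ) + 2 - z 0 -
            FcA κ Φ t p D g f (yL + Skelφ.crossOffY (nL κ Φ t p D g f) (ℓL κ Φ t p D g f) (hL κ Φ t p D g f) (vL κ Φ t p D g f) (sgOf du) (NrY κ Φ t p D g f P yL x du z))) ≤
        ((P.s 0 : ℕ) : ℤ) * modulus (nL κ Φ t p D g f) (hL κ Φ t p D g f) (vL κ Φ t p D g f) (vβL κ Φ t p D g f) *
              xCSLo (nL κ Φ t p D g f) (qB3YA κ Φ t p D g f (KS0.R'0 κ Φ t p D mk)) (KS0.R'0 κ Φ t p D mk) (σTY κ Φ t p D g f P yL x du z) (N3Y κ Φ t p D g f P yL x du z + 1) -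
            ((P.s 0 : ℕ) : ℤ) * (nL κ Φ t p D g f : ℤ) * (shearUnit (nL κ Φ t p D g f) (hL κ Φ t p D g f) : ℤ) *
              (xCoreB (nL κ Φ t p D g f) (ℓL κ Φ t p D g f) (hL κ Φ t p D g f) (KS0.R'0 κ Φ t p D mk) (N3Y κ Φ t p D g f P yL x du z + 1) + 1) -
          ((P.s 0 : ℕ) : ℤ) * (nL κ Φ t p D g f : ℤ) -
          (nL κ Φ t p D g f : ℤ) * modulus (nL κ Φ t p D g f) (hL κ Φ t p D g f) (vL κ Φ t p D g f) (vβL κ Φ t p D g f)) ∧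
    ((nL κ Φ t p D g f : ℤ) * modulus (nL κ Φ t p D g f) (hL κ Φ t p D g f) (vL κ Φ t p D g f) (vβL κ Φ t p D g f) *
            (FcA κ Φ t p D g f (yL + Skelφ.crossOffY (nL κ Φ t p D g f) (ℓL κ Φ t p D g f) (hL κ Φ t p D g f) (vL κ Φ t p D g f) (sgOf du) (NrY κ Φ t p D g f P yL x du z)) + 1) +
            ((P.s 0 : ℕ) : ℤ) * modulus (nL κ Φ t p D g f) (hL κ Φ t p D g f) (vL κ Φ t p D g f) (vβL κ Φ t p D g f) *
              xCSHi (nL κ Φ t p D g f) (qB3YA κ Φ t p D g f (KS0.R'0 κ Φ t p D mk)) (KS0.R'0 κ Φ t p D mk) (σTY κ Φ t p D g f P yL x du z) (N3Y κ Φ t p D g f P yL x du z + 1) +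
          ((P.s 0 : ℕ) : ℤ) * (nL κ Φ t p D g f : ℤ) * (shearUnit (nL κ Φ t p D g f) (hL κ Φ t p D g f) : ℤ) *
            (xCoreB (nL κ Φ t p D g f) (ℓL κ Φ t p D g f) (hL κ Φ t p D g f) (KS0.R'0 κ Φ t p D mk) (N3Y κ Φ t p D g f P yL x du z + 1) + 1) ≤
        (nL κ Φ t p D g f : ℤ) * modulus (nL κ Φ t p D g f) (hL κ Φ t p D g f) (vL κ Φ t p D g f) (vβL κ Φ t p D g f) *
          (P.cenS (x + stepVec du) 0 + ((NegB.BSlot.small κ Φ t p D g f 0 : ℕ) : ℤ) - 2 - z 0)) ∧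
    (modulus (nL κ Φ t p D g f) (hL κ Φ t p D g f) (vL κ Φ t p D g f) (vβL κ Φ t p D g f) *
          (P.cenS (x + stepVec du) 1 - ((NegB.BSlot.small κ Φ t p D g f 1 : ℕ) : ℤ) + 2 - z 1 -
            F1cA κ Φ t p D g f (yL + Skelφ.crossOffY (nL κ Φ t p D g f) (ℓL κ Φ t p D g f) (hL κ Φ t p D g f) (vL κ Φ t p D g f) (sgOf du) (NrY κ Φ t p D g f P yL x du z))) ≤
        -(u₁A κ Φ t p D g f * (shearUnit (nL κ Φ t p D g f) (hL κ Φ t p D g f) : ℤ) *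
            (xCoreB (nL κ Φ t p D g f) (ℓL κ Φ t p D g f) (hL κ Φ t p D g f) (KS0.R'0 κ Φ t p D mk) (N3Y κ Φ t p D g f P yL x du z + 1) + 1)) -
          modulus (nL κ Φ t p D g f) (hL κ Φ t p D g f) (vL κ Φ t p D g f) (vβL κ Φ t p D g f) + 1) ∧
    (modulus (nL κ Φ t p D g f) (hL κ Φ t p D g f) (vL κ Φ t p D g f) (vβL κ Φ t p D g f) *
            (F1cA κ Φ t p D g f (yL + Skelφ.crossOffY (nL κ Φ t p D g f) (ℓL κ Φ t p D g f) (hL κ Φ t p D g f) (vL κ Φ t p D g f) (sgOf du) (NrY κ Φ t p D g f P yL x du z)) + 1) +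
          u₁A κ Φ t p D g f * ((shearUnit (nL κ Φ t p D g f) (hL κ Φ t p D g f) : ℤ) *
              xCoreB (nL κ Φ t p D g f) (ℓL κ Φ t p D g f) (hL κ Φ t p D g f) (KS0.R'0 κ Φ t p D mk) (N3Y κ Φ t p D g f P yL x du z + 1) +
            shearUnit (nL κ Φ t p D g f) (hL κ Φ t p D g f) - 1) ≤
        modulus (nL κ Φ t p D g f) (hL κ Φ t p D g f) (vL κ Φ t p D g f) (vβL κ Φ t p D g f) *
          (P.cenS (x + stepVec du) 1 + ((NegB.BSlot.small κ Φ t p D g f 1 : ℕ) : ℤ) - 2 - z 1)) := by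
  have hu1 : 1 ≤ u₁A κ Φ t p D g f := (units_eqA κ Φ t p D g f).2.2.2.2.2
  have hR0 : (0 : ℤ) ≤ (KS0.R'0 κ Φ t p D mk : ℤ) := by positivity
  have hEu : (E : ℤ) ≤ 2 * u₁A κ Φ t p D g f := by linarith
  obtain ⟨hσT, -, -⟩ := N3Y_spec κ Φ t p D g f P yL x du z
  have hN3 := N3Y_range κ Φ t p D g f P hP yL x du hd z hz hkE he0 (by linarith)
  obtain ⟨hq3, hℓk⟩ := hq3_hℓk_YA κ Φ t p D g f mk hnA hℓ hN3
  have hT0 := hT0_YA κ Φ t p D g f mk P hP hN hκ hℓ hs0 x du hd j hj z hlev1 hlev2 hEu yL he1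
  have hT1 := hT1_YA κ Φ t p D g f mk P hP hN hκ hℓ x du hd j hj z hlev1 hlev2 hEu yL he1
  exact ⟨FL1_YA_gen κ Φ t p D mk g f P hP hN hκ x du z _ hσT hT0 hq3 hℓk hs0, FL2_YA_gen κ Φ t p D mk g f P hP hN hκ x du z _ hσT hT0 hq3 hℓk hs0,
    FL3_YA_gen κ Φ t p D mk g f P hN hκ x du z _ hT1 hℓk, FL4_YA_gen κ Φ t p D mk g f P hN hκ x du z _ hT1 hℓk⟩

end LAd

end KS

end NegB

end PlanarSkeletonFrm

end Summit.CriticalPhenomena.PercolationContinuityZ3.Theorems.Transplant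

end
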